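import Literature.NumberTheory.IwasawaTheory.ClassicalMuVanishesFiniteDescentShift
import Literature.NumberTheory.IwasawaTheory.ClassicalMuVanishesIffBoundedRank
import HarnessLib

set_option autoImplicit false

/-!
# `μ = 0` descends along EVERY finite extension of number fields — WITHOUT Iwasawa's growth theorem
# (Iwasawa 1973, §3, «`μ(K/k) ≤ μ(K'/k')`», the `μ = 0` half, growth form; hI-free twins of `ClassicalMuVanishesFiniteDescent[Shift]`)

Topic `NumberTheory/IwasawaTheory` (namespace = path).  THEOREM-ONLY file (no definition, no named fact, no `sorry`), written by the
prover seat `bsd-line-att-p4` g25 (cell `bsd-f1-sign2`; `--supports` stmt-BirchSwinnertonDyer-22298, where it removes the named fact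
`iwasawa1959_classNumberPExp_growth` from the necessity chain «C2 ⟹ `μ₂(ℚ(β)) = 0` ⟹ stabilising 2-ranks»; closes nothing).

The descents of `ClassicalMuVanishesFiniteDescent.lean` / `ClassicalMuVanishesFiniteDescentShift.lean` (cell bsd-2adic k4-w1) carry the hypothesis
`hI : iwasawa1959_classNumberPExp_growth` only through `classicalMuVanishes_of_classNumberPExp_le_linear` / `classicalMuVanishes_of_le_sum`
(«`pⁿ` outgrows a linear bound under the growth theorem»).  Seat `bsd-potss-k8t-c4` g22 proved the hI-FREE twins of those two lemmas
(`ClassicalMuVanishesIffBoundedRank.lean`: a linear upper bound ⟹ bounded `p`-ranks ⟹ growth form, all at finite level, Washington Prop. 13.23).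
Substituting them gives the finite descent with NO named-fact hypothesis:

* `classicalMuVanishes_of_shift_noGrowth` — `μ(κ') = 0 ⇒ μ(κ) = 0` for the shifted base change `κ'` (`p^a κ' = κ ∘ res`) of `κ` to a finite `K'/K`.
* `classicalMuVanishes_of_isCyclotomic_of_finite_noGrowth` — `K ⊆ K'` ANY finite extension of number fields, `κK` cyclotomic on `K`:
  «`μ = 0` for every cyclotomic `ℤ_p`-extension of `K'`» ⇒ `μ(κK) = 0`.
* `classicalMuVanishes_of_isCyclotomic_of_le_noGrowth` — the intermediate-field form (`E ≤ E'`).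
* `classicalMuVanishes_restrict_of_tower_finite_noGrowth`, `classicalMuVanishes_of_isCyclotomic_of_tower_finite_noGrowth` — the restricted-tower forms
  of `ClassicalMuVanishesFiniteDescent.lean`, hI-free.

Every consumer of the hI-versions can drop its `hI` binder by switching to the `_noGrowth` twin (same remaining arguments).

References: [Iwasawa1973MuInvariants] §3 (remark after Thm. 2); [Washington1997] Prop. 4.11, §13.1, §13.3 Prop. 13.23; [Lang1990] Ch. 5 §1 Thm. 1.2 (iii).
-/

noncomputable section

open scoped NumberField

open Field IntermediateField Literature.NumberTheory.GaloisRepresentations Literature.NumberTheory.EllipticCurves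
  Literature.NumberTheory.EllipticCurves.ZpExtension Literature.NumberTheory.NumberFields

namespace Literature.NumberTheory.IwasawaTheory

variable {K : Type} [Field K] [NumberField K] {p : ℕ} [Fact p.Prime]

/-- **`μ(κ') = 0 ⇒ μ(κ) = 0`** (growth form) for the shifted base change `κ'` of `κ` to a finite `K'/K` (`p^a κ' = κ ∘ res`), WITHOUT the growth
theorem: `e_m(κ) ≤ λ'·m + (|ν'| + [K' : K])` for `m ≥ n₀ + a` (`classNumberPExp_add_le_of_shift`), and a linear upper bound forces the growth form
(`classicalMuVanishes_of_classNumberPExp_le_linear'`). [cite: Iwasawa1973MuInvariants, §3 (remark after Thm. 2)] [cite: Washington1997, §13.3 Prop. 13.23] -/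
theorem classicalMuVanishes_of_shift_noGrowth (κ : ZpExtension K p) (K' : Type)
    [Field K'] [NumberField K'] [Algebra K K'] {a : ℕ} (κ' : ZpExtension K' p)
    (hs : ∀ σ : absoluteGaloisGroup K', (p : ℤ_[p]) ^ a * (κ' σ).toAdd = (κ (absGaloisRestrict K K' σ)).toAdd)
    (hμ : ClassicalMuVanishes κ') : ClassicalMuVanishes κ := by
  obtain ⟨l, ν, n₀, hlin⟩ := hμ
  refine classicalMuVanishes_of_classNumberPExp_le_linear' κ (a := l)
    (b := ν.natAbs + Module.finrank K K') (n₁ := n₀ + a) fun m hm => ?_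
  obtain ⟨n, rfl⟩ : ∃ n, m = n + a := ⟨m - a, by omega⟩
  have hn : n₀ ≤ n := by omega
  have h1 := classNumberPExp_add_le_of_shift κ K' κ' hs n
  have h2 : (classNumberPExp κ' n : ℤ) ≤ l * n + ν.natAbs := by
    rw [hlin n hn]
    have := @Int.le_natAbs ν
    linarith
  have h3 : classNumberPExp κ' n ≤ l * n + ν.natAbs := by exact_mod_cast h2
  nlinarith [Nat.zero_le (l * a)]

/-- **`μ = 0` descends along EVERY finite extension of number fields, WITHOUT the growth theorem**: for `K ⊆ K'` number fields and a cyclotomic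
`ℤ_p`-extension `κK` of `K`, if every cyclotomic `ℤ_p`-extension of `K'` has `μ = 0` (growth form) then so does `κK` — NO hypothesis on `K' ∩ K_∞`
(shifted base change, `exists_zpExtension_shift`, `isCyclotomic_of_shift`) and NO named fact. hI-free twin of `classicalMuVanishes_of_isCyclotomic_of_finite'`.
[cite: Iwasawa1973MuInvariants, §3 (remark after Thm. 2)] [cite: Washington1997, Prop. 4.11 and §13.1] -/
theorem classicalMuVanishes_of_isCyclotomic_of_finite_noGrowth
    (κK : ZpExtension K p) (hκK : κK.IsCyclotomic) (K' : Type) [Field K'] [NumberField K'] [Algebra K K']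
    (hμ : ∀ κ' : ZpExtension K' p, κ'.IsCyclotomic → ClassicalMuVanishes κ') : ClassicalMuVanishes κK := by
  obtain ⟨a, κ', hs⟩ := exists_zpExtension_shift κK K'
  exact classicalMuVanishes_of_shift_noGrowth κK K' κ' hs (hμ κ' (isCyclotomic_of_shift κK K' κ' hs hκK))

/-- **Intermediate-field form, WITHOUT the growth theorem**: for `E ≤ E'` intermediate fields of an extension `L/F` with `E`, `E'` number fields,
«`μ = 0` for every cyclotomic `ℤ_p`-extension of `E'`» ⇒ the same for `E`. hI-free twin of `classicalMuVanishes_of_isCyclotomic_of_le`.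
[cite: Iwasawa1973MuInvariants, §3 (remark after Thm. 2)] -/
theorem classicalMuVanishes_of_isCyclotomic_of_le_noGrowth {F L : Type} [Field F]
    [Field L] [Algebra F L] {E E' : IntermediateField F L} (hEE' : E ≤ E') [NumberField ↥E] [NumberField ↥E']
    (hμ : ∀ κ' : ZpExtension ↥E' p, κ'.IsCyclotomic → ClassicalMuVanishes κ')
    (κE : ZpExtension ↥E p) (hκE : κE.IsCyclotomic) : ClassicalMuVanishes κE := by
  letI : Algebra ↥E ↥E' := (IntermediateField.inclusion hEE').toRingHom.toAlgebra
  exact classicalMuVanishes_of_isCyclotomic_of_finite_noGrowth κE hκE ↥E' hμ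

section Tower

variable {F : Type} [Field F] [NumberField F]

/-- **`μ = 0` descends along every finite step `K ⊆ K'` of restricted towers, WITHOUT the growth theorem**: `μ(κ|_{K'}) = 0 ⇒ μ(κ|_K) = 0`
(`F ⊆ K ⊆ K'`, `κ ∘ res` onto for `K` and `K'`) — `classicalMuVanishes_of_le_sum'` with the single bound `e_n(κ|_K) ≤ e_n(κ|_{K'}) + v_p [K' : K]`
(`classNumberPExp_restrict_le_add_padicValNat_finrank`). hI-free twin of `classicalMuVanishes_restrict_of_tower_finite`.
[cite: Iwasawa1973MuInvariants, §3 (remark after Thm. 2)] [cite: Lang1990, Ch. 5 §1 Thm. 1.2 (iii) (pp. 124–129)] -/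
theorem classicalMuVanishes_restrict_of_tower_finite_noGrowth (κ : ZpExtension F p)
    (K K' : Type) [Field K] [NumberField K] [Algebra F K] [Field K'] [NumberField K'] [Algebra F K'] [Algebra K K']
    [IsScalarTower F K K']
    (hK : Function.Surjective (κ.toContinuousMonoidHom.comp (absGaloisRestrict F K)))
    (hK' : Function.Surjective (κ.toContinuousMonoidHom.comp (absGaloisRestrict F K')))
    (hμ : ClassicalMuVanishes (κ.restrict K' hK')) : ClassicalMuVanishes (κ.restrict K hK) := by
  refine classicalMuVanishes_of_le_sum' (κ.restrict K hK) (ι := Unit) (κs := fun _ => κ.restrict K' hK')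
    (c := fun _ => 1) (b := padicValNat p (Module.finrank K K')) (n₀ := 0) (fun n _ => ?_) (fun _ => hμ)
  simpa using classNumberPExp_restrict_le_add_padicValNat_finrank κ K K' hK hK' n

/-- **Consumer form (cyclotomic towers), WITHOUT the growth theorem**: `κ` the cyclotomic `ℤ_p`-extension of `F`, `F ⊆ K ⊆ K'` with `κ ∘ res_{F,K'}`
onto; «`μ = 0` for every cyclotomic `ℤ_p`-extension of `K'`» ⇒ the same for every cyclotomic `ℤ_p`-extension of `K`. hI-free twin of
`classicalMuVanishes_of_isCyclotomic_of_tower_finite`. [cite: Iwasawa1973MuInvariants, §3 (remark after Thm. 2)] [cite: Washington1997, §13.1] -/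
theorem classicalMuVanishes_of_isCyclotomic_of_tower_finite_noGrowth
    (κ : ZpExtension F p) (hκ : κ.IsCyclotomic) (K K' : Type) [Field K] [NumberField K] [Algebra F K] [Field K']
    [NumberField K'] [Algebra F K'] [Algebra K K'] [IsScalarTower F K K']
    (hK' : Function.Surjective (κ.toContinuousMonoidHom.comp (absGaloisRestrict F K')))
    (hμ : ∀ κ' : ZpExtension K' p, κ'.IsCyclotomic → ClassicalMuVanishes κ')
    (κK : ZpExtension K p) (hκK : κK.IsCyclotomic) : ClassicalMuVanishes κK := by
  have hK := surjective_comp_absGaloisRestrict_of_tower κ K K' hK'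
  have h1 : ClassicalMuVanishes (κ.restrict K hK) :=
    classicalMuVanishes_restrict_of_tower_finite_noGrowth κ K K' hK hK' (hμ _ (isCyclotomic_restrict κ hκ K' hK'))
  exact (classicalMuVanishes_iff_of_isCyclotomic _ _ (isCyclotomic_restrict κ hκ K hK) hκK).mp h1

end Tower

end Literature.NumberTheory.IwasawaTheory

end
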